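import Summits.AtomisticToContinuum.Crystallization.Theorems.FrustratedLawDichotomyCellF1cRow
import Summits.AtomisticToContinuum.Crystallization.Theorems.FrustratedLawDichotomyZoneKernel

/-!
# FrustratedLawDichotomy · crux `AperiodicFrustratedLawGap` (stmt-AtomisticToContinuum-27623) — class-A K-file tower, layer 4e-c:
the F1 ATLAS PAIRS and the TRANSPORTED row floor over the COMPLETE template (amendment D §D0 «atlas-pair registry … Hm := HostLikeAt (7/10) 2⁻¹⁰ 𝓐» /
amendment E; critic r1865 (B), r1868; decomp-a2c hand-2 g48)

Under the transported door (334) every booked row needs its root MARKED (`h0 : Hm μ 0`) so that the pull kernel's in-flow vanishes ((329) K1/K2).  For the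
class-A F1 row of record #110 `KF1c` this file supplies, for ANY atlas `𝓐 ⊇ pairsF1c`:
* `pairF1c F := (MF1c.image (posL F ∘ aF1), closedBall 0 13)` and `pairsF1c := pairF1c '' ratBox BF1` — the (pattern, window) pairs of the F1 cell (COUNTABLE:
  `pairsF1c_countable`; windows measurable: `pairsF1c_window`) = the F1 entries an atlas edition's registry prelude lists;
* ★ `hostLikeAt_zero_of_mem_KF1c` — every rooted `δ`-hard-core member of `KF1c` is marked at its root under `HostLikeAt δ τ 𝓐` (τ = 2⁻¹⁰) whenever
  `pairsF1c ⊆ 𝓐` (#103 `hostLikeAt_zero_of_mem`, `coherentAt = coherentOn _ _ (closedBall 0 Rc)` by `rfl`);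
* ★★ `hfloor_KF1c_transport` — the (334) `hfloor` line of the F1 row UNDER TRANSPORT: `CertF1c YF cUp mc → c ≤ cUp → pairsF1c ⊆ 𝓐 →` every rooted `7/10`-hard-core
  Nash `μ ∈ KF1c` has `c + mc ≤ rootEnergy V_LJ μ + net 0 (zonePull (HostLikeAt (7/10) (1/1024) 𝓐) R) μ` for every pull radius `R` (#110 `hfloor_KF1c_of_cert` + #103
  `floor_add_net_of_floor`/`hostLikeAt_hshift`).
Imports TREE #110 `…CellF1cRow` + #103 `…ZoneKernel`; 0 sorry.  Tags: [new: K-file layer / registry glue]; nothing here closes an item.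
-/

noncomputable section

namespace Summit.AtomisticToContinuum.Crystallization.Theorems.FrustratedLawDichotomyCellF1cAtlas

open MeasureTheory Metric Set
open scoped BigOperators
open Literature.MathematicalPhysics.StatisticalMechanics (lennardJones rootEnergy)
open Literature.Probability.Process (IsRootedHardCore)
open Summit.AtomisticToContinuum.Crystallization.Theorems.ChargedEnergyGapNegative (E3)
open Summit.AtomisticToContinuum.Crystallization.Theorems.FrustratedLawDichotomySignedLedger (net)
open Summit.AtomisticToContinuum.Crystallization.Theorems.FrustratedLawDichotomyCoherentSets (coherentAt)
open Summit.AtomisticToContinuum.Crystallization.Theorems.FrustratedLawDichotomyCoherentOn (coherentOn coherentAt_eq_coherentOn)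
open Summit.AtomisticToContinuum.Crystallization.Theorems.FrustratedLawDichotomyCellMetric (posL)
open Summit.AtomisticToContinuum.Crystallization.Theorems.FrustratedLawDichotomyCellRows (ratBox ratBox_countable)
open Summit.AtomisticToContinuum.Crystallization.Theorems.FrustratedLawDichotomyPullKernel (zonePull floor_add_net_of_floor)
open Summit.AtomisticToContinuum.Crystallization.Theorems.FrustratedLawDichotomyZoneKernel (HostLikeAt hostLikeAt_hshift hostLikeAt_zero_of_mem)
open Summit.AtomisticToContinuum.Crystallization.Theorems.FrustratedLawDichotomyCellF1cLabels (MF1c)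
open Summit.AtomisticToContinuum.Crystallization.Theorems.FrustratedLawDichotomyCellF1Symm (BF1)
open Summit.AtomisticToContinuum.Crystallization.Theorems.FrustratedLawDichotomyCellF1Pos (aF1)
open Summit.AtomisticToContinuum.Crystallization.Theorems.FrustratedLawDichotomyCellF1cRow (KF1c CertF1c hfloor_KF1c_of_cert)

/-- the atlas pair of the F1 cell at the strain `F`: (placed complete template, the `Rc`-ball window). -/
def pairF1c (F : Matrix (Fin 3) (Fin 3) ℝ) : Finset E3 × Set E3 := (MF1c.image fun m => posL F (aF1 m), closedBall (0 : E3) 13)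

/-- ★ the F1 ATLAS PAIRS: one pair per rational strain of the cell. -/
def pairsF1c : Set (Finset E3 × Set E3) := pairF1c '' ratBox BF1

/-- the F1 atlas pairs are countable (the registry prelude's `h𝓐` for its F1 entries). -/
theorem pairsF1c_countable : pairsF1c.Countable := (ratBox_countable BF1).image pairF1c

/-- every F1 atlas window is measurable (the registry prelude's `hW` for its F1 entries). -/
theorem pairsF1c_window : ∀ p ∈ pairsF1c, MeasurableSet p.2 := by
  rintro _ ⟨F, -, rfl⟩
  exact measurableSet_closedBall

variable {δ : ℝ} {𝓐 : Set (Finset E3 × Set E3)}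

/-- ★ THE ROOT OF AN F1 ROW MEMBER IS HOST-LIKE: for any atlas containing the F1 pairs, a rooted `δ`-hard-core `μ ∈ KF1c` is marked at `0`. -/
theorem hostLikeAt_zero_of_mem_KF1c (h𝓐 : pairsF1c ⊆ 𝓐) {μ : Measure E3} (hμ : IsRootedHardCore δ μ) (hrow : μ ∈ KF1c) :
    HostLikeAt δ (1 / 1024) 𝓐 μ 0 := by
  obtain ⟨F, hF, hcoh⟩ := Set.mem_iUnion₂.mp hrow
  rw [coherentAt_eq_coherentOn] at hcoh
  exact hostLikeAt_zero_of_mem hμ (h𝓐 ⟨F, hF, rfl⟩) hcoh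

/-- ★★ **THE F1 ROW FLOOR UNDER TRANSPORT** (the (334) `hfloor` line of the class-A F1 row over the complete template): from the K-certificate `CertF1c YF cUp mc`,
`c ≤ cUp`, and an atlas containing the F1 pairs, every rooted `7/10`-hard-core NASH configuration of `KF1c` satisfies
`c + mc ≤ rootEnergy V_LJ μ + net 0 (zonePull (HostLikeAt (7/10) 2⁻¹⁰ 𝓐) R) μ` — for every pull radius `R`. -/
theorem hfloor_KF1c_transport {YF : Matrix (Fin 3) (Fin 3) ℝ → ℤ × ℤ × ℤ → E3} {c mc cUp : ℝ} (hc : c ≤ cUp) (hcert : CertF1c YF cUp mc)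
    (h𝓐 : pairsF1c ⊆ 𝓐) (R : ℝ) :
    ∀ μ : Measure E3, IsRootedHardCore (7 / 10) μ →
      (∀ p : E3, μ {p} ≠ 0 → ∀ w : E3, (∀ q : E3, μ {q} ≠ 0 → q ≠ p → w ≠ q) →
        ∑' q : {q : E3 // μ {q} ≠ 0 ∧ q ≠ p}, lennardJones (dist p (q : E3)) ≤
          ∑' q : {q : E3 // μ {q} ≠ 0 ∧ q ≠ p}, lennardJones (dist w (q : E3))) →
      μ ∈ KF1c → c + mc ≤ rootEnergy lennardJones μ + net 0 (zonePull (HostLikeAt (7 / 10) (1 / 1024) 𝓐) R) μ :=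
  fun μ hμ hNash hrow =>
    floor_add_net_of_floor (hostLikeAt_hshift (7 / 10) (1 / 1024) 𝓐) (hostLikeAt_zero_of_mem_KF1c h𝓐 hμ hrow)
      (hfloor_KF1c_of_cert hc hcert μ hμ hNash hrow)

end Summit.AtomisticToContinuum.Crystallization.Theorems.FrustratedLawDichotomyCellF1cAtlas

end
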